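import Summits.ABC.IUTFork.Thm311RealInd1StripPacketDualBoxSharp
import Summits.ABC.IUTFork.Thm311RealInd1StripPacketMonomialFloor
import HarnessLib

/-!
# [IUTchIII] Thm 3.11 (i) (Ind1)+(Ind2), genuine packet of TAME factors of odd local degree `≥ 3` and ARBITRARY residue degrees: the packet junction identity
# holds IF AND ONLY IF the room inequality holds for `S = {f_i > 1} ∪ {bit_i}` — the two sides of rows R25 (identity, mod `JannsenWingbergMappingClass`) and
# R27/(λ) (strict confinement, unconditional) assembled into ONE displayed equivalence

PROOF-ONLY file (abc-iut cell, Cor. 3.12 sub-crew, seat abc-iut-c312-1 = holder of record of the typed [IUTchIII] Thm. 3.11, gen 20; row offer (λ); sequel of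
`Thm311RealInd1StripPacketDualBoxSharp`).  TAKES NO SIDE on [IUTchIII] Cor. 3.12.  No definition, no `Prop` fact.  CONDITIONAL on `JannsenWingbergMappingClass`
(displayed binder `hMC`, used ONLY in the direction room ⟹ identity; the direction identity ⟹ room is the unconditional converse of `…DualBoxSharp` §3).
SETTING.  Genuine packet `X = ⊗_{i∈I} K_{w_i}`, every factor TAME (`p > 2`, `e_i ≤ p − 2`) of ODD local degree `≥ 3` (the identity side's hypotheses, R25 (A)) and ANY
residue degree; `‖g‖ = p^{−v/E}`; a bit-valued ORACLE `bit : I → Prop` that is CORRECT at the residue-degree-one factors (`hbit`: where it says yes some realised strip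
automorphism moves `ℤ_p·p` modulo `p·log_p(𝒪^×)`; `hfix`: where it says no, none does) and is NOT READ at factors with `f_i > 1`; `H ≤ indTwo` containing the
single-factor strip moves (identity side) and acting factorwise through the realised strip groups (converse side) — e.g. the group generated by the single-factor
strip moves.  `S := {i : f_i ≠ 1 ∨ bit_i}`.
* **`packetHull_orbit_eq_container_iff_room_of_jannsenWingbergMappingClass`** — `packetHull(H-orbit of ι_{i₀}(g)·(R_I)^∼) = packetHull(p^{A}·log_p(R_I^×))`
  **⟺** `((v−1) % E + 1)/E + Σ_{i ∉ S} 1/e_i ≤ 1` (⟸: R25 (A) `…_eq_of_bitsOn_…` BY NAME, mod hMC; ⟹: `…DualBoxSharp` §3 BY NAME, unconditional).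
* NON-VACUITY **`exists_subgroup_le_indTwo_stripMoves_factorwise`** — the THREE hypotheses on `H` are jointly inhabited: the subgroup generated by the single-factor
  strip moves lying in `indTwo` is `≤ indTwo`, contains every single-factor strip move (R21 `exists_linearEquiv_stripMove` + `mem_indTwo_of_printInd1Ind2`) and acts
  factorwise through the realised strip groups (p554348 §2 `factorwise_of_mem_closure_singleFactor`) — UNCONDITIONAL.
READING (numbers about OUR typed objects; neutral): at tame packets of odd local degree `≥ 3` and ARBITRARY residue degrees the packet junction identity of the
Θ-region is decided by ONE real inequality in the ramification indices, the residue `r = (v−1) mod E` and the set of residue-degree-one factors whose bit holds;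
factors of residue degree `> 1` enter with NO bit.  Which value a bit takes at a given place is NOT claimed; HONEST SCOPE: ⟸ mod `JannsenWingbergMappingClass`,
⟹ unconditional; OUR typings (THE equivariant lift, THE logarithm, factorwise action; F-B28-1 untouched); EVEN degree, WILD, `p = 2` outside; equal-AS-TYPED ≠ equal in
print; nothing here asserts that abc is proved or refuted; no side taken on [IUTchIII] Cor. 3.12 / [IUTchIV] Thm. 1.10, on (U) vs (P), or on any author.
[claim: Mochizuki2012, status: disputed]; [cite: Mochizuki2012, IUTchIII Thm. 3.11 (i) p. 154; Rmk. 3.9.5 (i) p. 127; Cor. 3.12 Step (xi) p. 183; IUTchIV Prop. 1.1 p. 9,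
Prop. 1.2 (ii) pp. 10–11]; [cite: Kondo2025OuterAutMLF, §3 Thm 3.17, Rem 3.18]; [cite: DupuyHilado2025, §4.9, §4.12]. typed ≠ proved; a conditional theorem discharges
nothing it binds.
-/

set_option autoImplicit false

noncomputable section

open Metric Set Bornology Function Module
open scoped Pointwise TensorProduct NormedField

namespace Summit.ABC.IUTFork.Thm311.Real

open NumberField IsDedekindDomain Literature.NumberTheory.NumberFields Literature.IUT.LogVolume
open Literature.NumberTheory.GaloisRepresentations Literature.NumberTheory.GaloisRepresentations.Ultrametric
open Literature.AnabelianGeometry.AbsoluteAnabelian Literature.IUT.HodgeArakelov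
open Literature.IUT.HodgeArakelov.AbsTopMonoids

variable {K : Type} [Field K] [NumberField K] (p : ℕ) [hp : Fact p.Prime]
variable {I : Type} [Fintype I] [DecidableEq I] (w : I → HeightOneSpectrum (𝓞 K)) (hw : ∀ i, ((p : ℕ) : 𝓞 K) ∈ (w i).asIdeal)

/-- **THE PACKET JUNCTION IDENTITY ⟺ THE ROOM INEQUALITY (tame, odd local degree `≥ 3`, ANY residue degrees; ⟸ mod `JannsenWingbergMappingClass`, ⟹ unconditional).**
With a bit oracle `bit` correct at the residue-degree-one factors (`hbit`, `hfix`) and `S = {i : f_i ≠ 1 ∨ bit_i}`: for every `H ≤ indTwo` containing the single-factor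
strip moves and acting factorwise through the realised strip groups,
`packetHull(H-orbit of ι_{i₀}(g)·(R_I)^∼) = packetHull(p^{A}·log_p(R_I^×)) ⟺ ((v−1) % E + 1)/E + Σ_{i∉S} 1/e_i ≤ 1`.
⟸ is R25 (A) `packetHull_iUnion_image_iota_smul_normalizedPacket_eq_of_bitsOn_of_jannsenWingbergMappingClass` (the bit is asked on `S` only at `f_i = 1`); ⟹ is the
contrapositive of `packetHull_orbit_ne_container_of_not_room_mixed` (off `S`: `f_i = 1`, so `e_i = [K_{w_i}:ℚ_p] ≥ 3`, and the bit fails).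
[claim: Mochizuki2012, status: disputed] [cite: Mochizuki2012, IUTchIII Thm. 3.11 (i) p. 154; Cor. 3.12 Step (xi) p. 183; IUTchIV Prop. 1.1 p. 9, Prop. 1.2 (ii) p. 10]
[cite: Kondo2025OuterAutMLF, §3 Thm 3.17, Rem 3.18] [cite: DupuyHilado2025, §4.9, §4.12] -/
theorem packetHull_orbit_eq_container_iff_room_of_jannsenWingbergMappingClass
    (hMC : JannsenWingbergMappingClass) (hp2 : 2 < p)
    (he : ∀ i, absRamificationIdx p (RescaledCompletion K p (w i) (hw i)) ≤ p - 2)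
    (h3 : ∀ i, 3 ≤ localDeg K (w i)) (hodd : ∀ i, Odd (localDeg K (w i)))
    (i₀ : I) {g : RescaledCompletion K p (w i₀) (hw i₀)} {v : ℤ}
    (hv : ‖g‖ = (p : ℝ) ^ (-(v / (absRamificationIdx p (RescaledCompletion K p (w i₀) (hw i₀)) : ℝ))))
    (bit : I → Prop) [DecidablePred bit]
    (hbit : ∀ i, (w i).asIdeal.inertiaDeg ℤ = 1 → bit i →
      ∃ ψ ∈ ind1StripOf (w i) (galoisLog (w i)),
        RescaledCompletion.of K p (w i) (hw i) (ψ (p : (w i).adicCompletion K)) - (p : RescaledCompletion K p (w i) (hw i)) ∉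
          (p : ℚ_[p]) • logUnits (RescaledCompletion K p (w i) (hw i)))
    (hfix : ∀ i, (w i).asIdeal.inertiaDeg ℤ = 1 → ¬ bit i → ∀ ψ ∈ ind1StripOf (w i) (galoisLog (w i)),
      RescaledCompletion.of K p (w i) (hw i) (ψ (p : (w i).adicCompletion K)) - (p : RescaledCompletion K p (w i) (hw i)) ∈
        (p : ℚ_[p]) • logUnits (RescaledCompletion K p (w i) (hw i)))
    (H : Subgroup (PacketAlgebra p (fun i => RescaledCompletion K p (w i) (hw i)) ≃ₗ[ℚ_[p]]
      PacketAlgebra p (fun i => RescaledCompletion K p (w i) (hw i))))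
    (hH : H ≤ indTwo p (fun i => RescaledCompletion K p (w i) (hw i)))
    (hstrip : ∀ (i₁ : I), ∀ ψ ∈ ind1StripOf (w i₁) (galoisLog (w i₁)), ∃ γ ∈ H,
      ∀ z : Π i, RescaledCompletion K p (w i) (hw i),
        (γ : PacketAlgebra p (fun i => RescaledCompletion K p (w i) (hw i)) ≃ₗ[ℚ_[p]]
            PacketAlgebra p (fun i => RescaledCompletion K p (w i) (hw i))) (PiTensorProduct.tprod ℚ_[p] z) =
          PiTensorProduct.tprod ℚ_[p] (update z i₁ (RescaledCompletion.of K p (w i₁) (hw i₁)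
            (ψ ((RescaledCompletion.of K p (w i₁) (hw i₁)).symm (z i₁))))))
    (hHfac : ∀ γ ∈ H, ∃ δ : Π i, AddAut ((w i).adicCompletion K),
      (∀ i, δ i ∈ AddSubgroup.closure (G := AddAut ((w i).adicCompletion K)) (ind1StripOf (w i) (galoisLog (w i)))) ∧
      ∀ z : Π i, RescaledCompletion K p (w i) (hw i),
        γ (PiTensorProduct.tprod ℚ_[p] z) =
          PiTensorProduct.tprod ℚ_[p] (fun i => RescaledCompletion.of K p (w i) (hw i)
            (δ i ((RescaledCompletion.of K p (w i) (hw i)).symm (z i))))) :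
    packetHull p (fun i => RescaledCompletion K p (w i) (hw i))
        (⋃ γ : H, (γ : PacketAlgebra p (fun i => RescaledCompletion K p (w i) (hw i)) ≃ₗ[ℚ_[p]]
            PacketAlgebra p (fun i => RescaledCompletion K p (w i) (hw i))) ''
          (iota p (fun i => RescaledCompletion K p (w i) (hw i)) i₀ g •
            (normalizedPacket p (fun i => RescaledCompletion K p (w i) (hw i)) :
              Set (PacketAlgebra p (fun i => RescaledCompletion K p (w i) (hw i)))))) =
      packetHull p (fun i => RescaledCompletion K p (w i) (hw i))
        (((p : ℚ_[p]) ^ ((v - 1) / (absRamificationIdx p (RescaledCompletion K p (w i₀) (hw i₀)) : ℤ) + 1 - Fintype.card I)) •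
          (logPacket p (fun i => RescaledCompletion K p (w i) (hw i)) :
            Set (PacketAlgebra p (fun i => RescaledCompletion K p (w i) (hw i))))) ↔
    (((v - 1) % (absRamificationIdx p (RescaledCompletion K p (w i₀) (hw i₀)) : ℤ) + 1 : ℤ) : ℝ) /
        (absRamificationIdx p (RescaledCompletion K p (w i₀) (hw i₀)) : ℝ) +
      ∑ i ∈ Finset.univ \ Finset.univ.filter (fun i => (w i).asIdeal.inertiaDeg ℤ ≠ 1 ∨ bit i),
        (1 : ℝ) / (absRamificationIdx p (RescaledCompletion K p (w i) (hw i)) : ℝ) ≤ 1 := by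
  classical
  haveI : Nonempty I := ⟨i₀⟩
  set S : Finset I := Finset.univ.filter (fun i => (w i).asIdeal.inertiaDeg ℤ ≠ 1 ∨ bit i) with hS
  have hmemS : ∀ i, i ∈ S ↔ (w i).asIdeal.inertiaDeg ℤ ≠ 1 ∨ bit i := fun i => by simp [hS]
  -- off `S`: residue degree one, the bit fails, `e_i = [K_{w_i} : ℚ_p] ≥ 3`
  have hfS : ∀ i, i ∉ S → (w i).asIdeal.inertiaDeg ℤ = 1 := fun i hi => by
    by_contra h; exact hi ((hmemS i).mpr (Or.inl h))
  have hbS : ∀ i, i ∉ S → ¬ bit i := fun i hi hb => hi ((hmemS i).mpr (Or.inr hb))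
  have he2 : ∀ i, i ∉ S → 2 ≤ absRamificationIdx p (RescaledCompletion K p (w i) (hw i)) := fun i hi => by
    have h := h3 i
    rw [localDeg, hfS i hi, mul_one, ← absRamificationIdx_rescaledCompletion K p (w i) (hw i)] at h
    omega
  have hd2 : ∀ i, 2 ≤ localDeg K (w i) := fun i => le_trans (by norm_num) (h3 i)
  constructor
  · intro hEq
    by_contra hnot
    exact packetHull_orbit_ne_container_of_not_room_mixed p w hw hp2 he hd2 i₀ hv S he2 hfS
      (fun i hi => hfix i (hfS i hi) (hbS i hi)) hnot H hHfac hEq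
  · intro hroom
    exact packetHull_iUnion_image_iota_smul_normalizedPacket_eq_of_bitsOn_of_jannsenWingbergMappingClass p w hw hMC hp2 he h3 hodd i₀ hv S
      hroom (fun i hi hf1 => hbit i hf1 (((hmemS i).mp hi).resolve_left (fun h => h hf1))) H hH hstrip

/-! ## Non-vacuity of the hypotheses on `H` -/

omit [Fintype I] in
/-- **NON-VACUITY: the three hypotheses on `H` of the equivalence are jointly inhabited (UNCONDITIONAL).**  On the genuine packet `⊗_i K_{w_i}` the subgroup
generated by the single-factor (Ind1) strip moves that lie in `indTwo` is `≤ indTwo`, CONTAINS every single-factor strip move (each is realised by a print-dominated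
packet automorphism — R21 `exists_linearEquiv_stripMove` — hence lies in `indTwo`, `mem_indTwo_of_printInd1Ind2`), and ACTS FACTORWISE through the realised strip
groups (p554348 §2 `factorwise_of_mem_closure_singleFactor`).  So `packetHull_orbit_eq_container_iff_room_of_jannsenWingbergMappingClass` speaks about an inhabited
class of `H`. [claim: Mochizuki2012, status: disputed] [cite: Mochizuki2012, IUTchIII Thm. 3.11 (i) p. 154] [cite: DupuyHilado2025, §4.9] -/
theorem exists_subgroup_le_indTwo_stripMoves_factorwise :
    ∃ H : Subgroup (PacketAlgebra p (fun i => RescaledCompletion K p (w i) (hw i)) ≃ₗ[ℚ_[p]]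
        PacketAlgebra p (fun i => RescaledCompletion K p (w i) (hw i))),
      H ≤ indTwo p (fun i => RescaledCompletion K p (w i) (hw i)) ∧
      (∀ (i₁ : I), ∀ ψ ∈ ind1StripOf (w i₁) (galoisLog (w i₁)), ∃ γ ∈ H,
        ∀ z : Π i, RescaledCompletion K p (w i) (hw i),
          (γ : PacketAlgebra p (fun i => RescaledCompletion K p (w i) (hw i)) ≃ₗ[ℚ_[p]]
              PacketAlgebra p (fun i => RescaledCompletion K p (w i) (hw i))) (PiTensorProduct.tprod ℚ_[p] z) =
            PiTensorProduct.tprod ℚ_[p] (update z i₁ (RescaledCompletion.of K p (w i₁) (hw i₁)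
              (ψ ((RescaledCompletion.of K p (w i₁) (hw i₁)).symm (z i₁)))))) ∧
      ∀ γ ∈ H, ∃ δ : Π i, AddAut ((w i).adicCompletion K),
        (∀ i, δ i ∈ AddSubgroup.closure (G := AddAut ((w i).adicCompletion K)) (ind1StripOf (w i) (galoisLog (w i)))) ∧
        ∀ z : Π i, RescaledCompletion K p (w i) (hw i),
          γ (PiTensorProduct.tprod ℚ_[p] z) =
            PiTensorProduct.tprod ℚ_[p] (fun i => RescaledCompletion.of K p (w i) (hw i)
              (δ i ((RescaledCompletion.of K p (w i) (hw i)).symm (z i)))) := by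
  classical
  let Sg : Set (PacketAlgebra p (fun i => RescaledCompletion K p (w i) (hw i)) ≃ₗ[ℚ_[p]]
      PacketAlgebra p (fun i => RescaledCompletion K p (w i) (hw i))) :=
    {γ | γ ∈ indTwo p (fun i => RescaledCompletion K p (w i) (hw i)) ∧
      ∃ (i₀ : I) (ψ : (w i₀).adicCompletion K ≃+ (w i₀).adicCompletion K), ψ ∈ ind1StripOf (w i₀) (galoisLog (w i₀)) ∧
        ∀ z : Π i, RescaledCompletion K p (w i) (hw i),
          γ (PiTensorProduct.tprod ℚ_[p] z) =
            PiTensorProduct.tprod ℚ_[p] (update z i₀ (RescaledCompletion.of K p (w i₀) (hw i₀)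
              (ψ ((RescaledCompletion.of K p (w i₀) (hw i₀)).symm (z i₀)))))}
  refine ⟨Subgroup.closure Sg, (Subgroup.closure_le _).mpr fun γ hγ => hγ.1, fun i₁ ψ hψ => ?_, fun γ hγ => ?_⟩
  · obtain ⟨γ, ⟨φ, hφ, hγφ⟩, hγ⟩ := exists_linearEquiv_stripMove p w hw i₁ hψ
    exact ⟨γ, Subgroup.subset_closure ⟨mem_indTwo_of_printInd1Ind2 p w hw φ hφ γ hγφ, i₁, ψ, hψ, hγ⟩, hγ⟩
  · exact factorwise_of_mem_closure_singleFactor p w hw Sg (fun γ' hγ' => hγ'.2) hγ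

end Summit.ABC.IUTFork.Thm311.Real
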